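import Literature.Geometry.Riemannian.MeanConvexSurrounding
import Mathlib.Analysis.InnerProductSpace.Calculus
import Mathlib.LinearAlgebra.FiniteDimensional.Lemmas

/-!
# Lawson–Michelsohn (1984), Theorem 6.1 in `ℝ^{m+1}` — proof file, part 1: the Hessian-trace
# form of mean convexity and the round ball

Topic `Geometry/Riemannian`; namespace `Literature.Geometry.Riemannian`. Companion of
`MeanConvexSurrounding.lean`, which states the named fact
`Literature.Geometry.Riemannian.LawsonMichelsohn1984_surrounding` (H. B. Lawson, M.-L. Michelsohn,
*Embedding and surrounding with positive mean curvature*, Invent. Math. 77 (1984), Thm. (6.1) for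
`M̄ = ℝ^{m+1}`, `m ≥ 4`). Everything in this file is **proved**; no statement is introduced.

The fact renders "the hypersurface `{F' = 0}` has positive mean curvature with respect to the
outer normal `∇F'/‖∇F'‖` of the compact domain `{F' ≤ 0}`" in the calculus vocabulary of Mathlib
as: for every `x ∈ {F' = 0}` and every orthonormal `m`-frame `v` of `ker dF'(x)`,
`0 < ∑ᵢ D²F'(x)(vᵢ, vᵢ)` (op. cit. §2, (2.4)–(2.6): for the unit normal `ν = ∇F/‖∇F‖` of a
regular level the second fundamental form on tangent vectors is `Hess F/‖∇F‖`, so the sum is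
`‖∇F'(x)‖ · H(x)`). This file supplies the two elementary facts about this rendering that every
verification of it uses, and the base case of the surrounding construction:

* `sum_iteratedFDeriv_two_eq_of_orthonormal` — **frame independence**: for `df(x) ≠ 0` on
  `ℝ^{m+1}` the sum `∑ᵢ D²f(x)(vᵢ, vᵢ)` is the same for all orthonormal `m`-frames `v` of
  `ker df(x)` (an orthonormal `m`-frame of the `m`-dimensional kernel is an orthonormal basis, and
  the sum is the trace of the compressed Hessian; pure linear algebra:
  `sum_apply_orthonormalBasis_eq`, `sum_apply_eq_of_orthonormal`); hence
  `sum_iteratedFDeriv_two_pos_of_exists` — **one positive frame suffices**.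
* `roundBall_presentation` — the round ball `{‖y - c‖² - r² ≤ 0}`, `r > 0`, `m ≥ 1`, satisfies
  every `F'`-clause of the conclusion of the fact (smooth, compact sublevel set, regular zero
  level, `∑ᵢ D²F₀(vᵢ, vᵢ) = 2m > 0`): the `0`-handle `D₀` from which the proof of Thm. (6.1) grows
  the surrounding hypersurface by attaching handles of codimension `≥ 2` (op. cit. Thm. (3.1),
  §6).

* `RelPiOneTrivial.image_homeomorph` — the `1`-thin hypothesis `π₁(D, ∂D) = 0` (compression
  form, `RelPiOneTrivial`) is invariant under homeomorphisms of pairs, so it can be moved from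
  the subspace `{F ≤ 0} ⊆ ℝ^{m+1}` of the statement to any model of the domain.

Not here (later parts): the topology of regular compact sublevel domains `{F ≤ 0}` (boundary,
interior, connectedness, the manifold-with-boundary structure), the handle-attaching theorem
(3.1), the handle decomposition of a `1`-thin domain without handles of index `≥ m`
(Smale, Wall), and the assembly of Thm. (6.1).

## References

* H. B. Lawson, Jr., M.-L. Michelsohn, *Embedding and surrounding with positive mean curvature*,
  Invent. Math. 77 (1984), 399–419, doi:10.1007/bf01388830: §2 (2.4)–(2.6), Thm. (3.1), §6
  Thm. (6.1). [LawsonMichelsohn1984]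
-/

noncomputable section

open scoped Manifold ContDiff RealInnerProductSpace
open Set Module

namespace Literature.Geometry.Riemannian

section LinearAlgebra

variable {E : Type*} [NormedAddCommGroup E] [InnerProductSpace ℝ E]

/-- For a bilinear form `B` on a real inner product space and two finite orthonormal bases
`b`, `b'`, the sums `∑ᵢ B(bᵢ, bᵢ)` agree (both are the trace of `B`). [folklore] -/
theorem sum_apply_orthonormalBasis_eq {ι ι' : Type*} [Fintype ι] [Fintype ι']
    (B : E →ₗ[ℝ] E →ₗ[ℝ] ℝ) (b : OrthonormalBasis ι ℝ E) (b' : OrthonormalBasis ι' ℝ E) :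
    ∑ i, B (b i) (b i) = ∑ j, B (b' j) (b' j) := by
  classical
  -- expand each `b i` in the basis `b'`
  have hexp : ∀ i, B (b i) (b i) = ∑ j, ∑ k, (⟪b' j, b i⟫ * ⟪b i, b' k⟫) * B (b' k) (b' j) := by
    intro i
    conv_lhs => rw [← b'.sum_repr' (b i)]
    simp only [map_sum, map_smul, LinearMap.sum_apply, LinearMap.smul_apply, smul_eq_mul,
      Finset.mul_sum]
    refine Finset.sum_congr rfl fun j _ => Finset.sum_congr rfl fun k _ => ?_
    rw [real_inner_comm (b i) (b' k)]
    ring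
  simp_rw [hexp]
  rw [Finset.sum_comm]
  refine Finset.sum_congr rfl fun j _ => ?_
  rw [Finset.sum_comm]
  have hpar : ∀ k, ∑ i, ⟪b' j, b i⟫ * ⟪b i, b' k⟫ = ⟪b' j, b' k⟫ := fun k =>
    b.sum_inner_mul_inner (b' j) (b' k)
  have : ∀ k, ∑ i, (⟪b' j, b i⟫ * ⟪b i, b' k⟫) * B (b' k) (b' j)
      = ⟪b' j, b' k⟫ * B (b' k) (b' j) := fun k => by
    rw [← Finset.sum_mul, hpar k]
  simp_rw [this]
  have hon := orthonormal_iff_ite.mp b'.orthonormal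
  simp_rw [hon j]
  simp

/-- Frame independence on a subspace: for a bilinear form `B` on `E` and two orthonormal bases of
the same subspace `K`, the sums `∑ᵢ B(bᵢ, bᵢ)` agree. [folklore] -/
theorem sum_apply_orthonormalBasis_submodule_eq {ι ι' : Type*} [Fintype ι] [Fintype ι']
    {K : Submodule ℝ E} (B : E →ₗ[ℝ] E →ₗ[ℝ] ℝ) (b : OrthonormalBasis ι ℝ K)
    (b' : OrthonormalBasis ι' ℝ K) :
    ∑ i, B (b i) (b i) = ∑ j, B (b' j) (b' j) :=
  sum_apply_orthonormalBasis_eq (B.compl₁₂ K.subtype K.subtype) b b'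

/-- An orthonormal family of `finrank K` vectors lying in a subspace `K` is an orthonormal basis
of `K`. [folklore] -/
theorem exists_orthonormalBasis_coe_eq {ι : Type*} [Fintype ι] {K : Submodule ℝ E}
    [FiniteDimensional ℝ K] {v : ι → E} (hv : Orthonormal ℝ v) (hvK : ∀ i, v i ∈ K)
    (hcard : Fintype.card ι = finrank ℝ K) :
    ∃ b : OrthonormalBasis ι ℝ K, ∀ i, (b i : E) = v i := by
  classical
  set w : ι → K := fun i => ⟨v i, hvK i⟩ with hw
  have hwo : Orthonormal ℝ w := by
    rw [orthonormal_iff_ite] at hv ⊢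
    intro i j
    simpa [hw, Submodule.coe_inner] using hv i j
  have hsp : ⊤ ≤ Submodule.span ℝ (Set.range w) :=
    (hwo.linearIndependent.span_eq_top_of_card_eq_finrank' hcard).ge
  exact ⟨OrthonormalBasis.mk hwo hsp, fun i => by simp [hw]⟩

/-- **Frame independence of the trace of a bilinear form on a subspace.** If `v` and `w` are two
orthonormal families of `finrank K` vectors of a subspace `K`, then
`∑ᵢ B(vᵢ, vᵢ) = ∑ⱼ B(wⱼ, wⱼ)`. [folklore] -/
theorem sum_apply_eq_of_orthonormal {ι ι' : Type*} [Fintype ι] [Fintype ι'] {K : Submodule ℝ E}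
    [FiniteDimensional ℝ K] (B : E →ₗ[ℝ] E →ₗ[ℝ] ℝ) {v : ι → E} {w : ι' → E}
    (hv : Orthonormal ℝ v) (hvK : ∀ i, v i ∈ K) (hcv : Fintype.card ι = finrank ℝ K)
    (hw : Orthonormal ℝ w) (hwK : ∀ j, w j ∈ K) (hcw : Fintype.card ι' = finrank ℝ K) :
    ∑ i, B (v i) (v i) = ∑ j, B (w j) (w j) := by
  obtain ⟨b, hb⟩ := exists_orthonormalBasis_coe_eq hv hvK hcv
  obtain ⟨b', hb'⟩ := exists_orthonormalBasis_coe_eq hw hwK hcw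
  have := sum_apply_orthonormalBasis_submodule_eq B b b'
  simpa [hb, hb'] using this

/-- The kernel of a nonzero linear functional on a finite-dimensional space has codimension one.
[folklore] -/
theorem finrank_ker_add_one_of_ne_zero {V : Type*} [AddCommGroup V] [Module ℝ V]
    [FiniteDimensional ℝ V] {L : V →ₗ[ℝ] ℝ} (hL : L ≠ 0) :
    finrank ℝ (LinearMap.ker L) + 1 = finrank ℝ V := by
  have hr : LinearMap.range L = ⊤ := by
    obtain ⟨u, hu⟩ : ∃ u, L u ≠ 0 := by simpa using DFunLike.ne_iff.mp hL
    refine eq_top_iff.mpr fun t _ => ⟨(t / L u) • u, ?_⟩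
    simp [div_mul_cancel₀ t hu]
  have h := LinearMap.finrank_range_add_finrank_ker L
  rw [hr, finrank_top, Module.finrank_self] at h
  omega

end LinearAlgebra

section HessianTrace

variable {E : Type*} [NormedAddCommGroup E] [InnerProductSpace ℝ E] {m : ℕ}

/-- The second derivative `D²f(x)(a, b)` in the `![a, b]` form used by
`LawsonMichelsohn1984_surrounding` is the bilinear map `fderiv ℝ (fderiv ℝ f) x`. [folklore] -/
theorem iteratedFDeriv_two_vecCons (f : E → ℝ) (x a b : E) :
    iteratedFDeriv ℝ 2 f x ![a, b] = fderiv ℝ (fderiv ℝ f) x a b := by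
  rw [iteratedFDeriv_two_apply]
  simp

/-- The kernel of `df(x) ≠ 0` on an `(m+1)`-dimensional space has dimension `m` (it is the
tangent space `T_x {f = f x}` of the regular level). [folklore] -/
theorem finrank_ker_fderiv_eq [FiniteDimensional ℝ E] (hE : finrank ℝ E = m + 1) {f : E → ℝ}
    {x : E} (hf : fderiv ℝ f x ≠ 0) :
    finrank ℝ (LinearMap.ker (fderiv ℝ f x : E →ₗ[ℝ] ℝ)) = m := by
  have hL : (fderiv ℝ f x : E →ₗ[ℝ] ℝ) ≠ 0 := by
    rwa [Ne, ← ContinuousLinearMap.toLinearMap_zero, ContinuousLinearMap.coe_inj]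
  have h := finrank_ker_add_one_of_ne_zero hL
  omega

/-- **Frame independence of the Hessian trace on the tangent space of a regular level.** For
`df(x) ≠ 0` on an `(m+1)`-dimensional real inner product space and two orthonormal `m`-frames
`v`, `w` of `ker df(x)`, `∑ᵢ D²f(x)(vᵢ, vᵢ) = ∑ᵢ D²f(x)(wᵢ, wᵢ)`: both are the trace of the
Hessian compressed to `ker df(x) = T_x{f = f x}`, i.e. `‖∇f(x)‖` times the mean curvature of the
level through `x` (Lawson–Michelsohn 1984, §2, (2.4)–(2.6)). Hence the positivity clause of
`LawsonMichelsohn1984_surrounding` does not depend on the frame. [folklore] -/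
theorem sum_iteratedFDeriv_two_eq_of_orthonormal [FiniteDimensional ℝ E]
    (hE : finrank ℝ E = m + 1) {f : E → ℝ} {x : E} (hf : fderiv ℝ f x ≠ 0) {v w : Fin m → E}
    (hv : Orthonormal ℝ v) (hvf : ∀ i, fderiv ℝ f x (v i) = 0)
    (hw : Orthonormal ℝ w) (hwf : ∀ i, fderiv ℝ f x (w i) = 0) :
    ∑ i, iteratedFDeriv ℝ 2 f x ![v i, v i] = ∑ i, iteratedFDeriv ℝ 2 f x ![w i, w i] := by
  set K : Submodule ℝ E := LinearMap.ker (fderiv ℝ f x : E →ₗ[ℝ] ℝ) with hK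
  have hKm : finrank ℝ K = m := finrank_ker_fderiv_eq hE hf
  set B : E →ₗ[ℝ] E →ₗ[ℝ] ℝ :=
    (ContinuousLinearMap.coeLM ℝ).comp (fderiv ℝ (fderiv ℝ f) x).toLinearMap with hB
  have hBapp : ∀ a b, B a b = iteratedFDeriv ℝ 2 f x ![a, b] := fun a b => by
    rw [iteratedFDeriv_two_vecCons]; rfl
  simp_rw [← hBapp]
  have hcard : Fintype.card (Fin m) = finrank ℝ K := by rw [hKm, Fintype.card_fin]
  exact sum_apply_eq_of_orthonormal B hv (fun i => (hvf i : _)) hcard hw (fun i => (hwf i : _))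
    hcard

/-- **One positive frame suffices.** If `df(x) ≠ 0` and `∑ᵢ D²f(x)(wᵢ, wᵢ) > 0` for *some*
orthonormal `m`-frame `w` of `ker df(x)`, then it is positive for *every* such frame (the form in
which the mean-convexity clause of `LawsonMichelsohn1984_surrounding` is verified in practice).
[folklore] -/
theorem sum_iteratedFDeriv_two_pos_of_exists [FiniteDimensional ℝ E] (hE : finrank ℝ E = m + 1)
    {f : E → ℝ} {x : E} (hf : fderiv ℝ f x ≠ 0)
    (h : ∃ w : Fin m → E, Orthonormal ℝ w ∧ (∀ i, fderiv ℝ f x (w i) = 0) ∧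
      0 < ∑ i, iteratedFDeriv ℝ 2 f x ![w i, w i])
    (v : Fin m → E) (hv : Orthonormal ℝ v) (hvf : ∀ i, fderiv ℝ f x (v i) = 0) :
    0 < ∑ i, iteratedFDeriv ℝ 2 f x ![v i, v i] := by
  obtain ⟨w, hw, hwf, hpos⟩ := h
  rwa [sum_iteratedFDeriv_two_eq_of_orthonormal hE hf hv hvf hw hwf]

/-- `sum_iteratedFDeriv_two_eq_of_orthonormal` in the setting of the fact: `ℝ^{m+1}` as
`EuclideanSpace ℝ (Fin (m + 1))`. [folklore] -/
theorem sum_iteratedFDeriv_two_eq_of_orthonormal_euclidean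
    {f : EuclideanSpace ℝ (Fin (m + 1)) → ℝ} {x : EuclideanSpace ℝ (Fin (m + 1))}
    (hf : fderiv ℝ f x ≠ 0) {v w : Fin m → EuclideanSpace ℝ (Fin (m + 1))}
    (hv : Orthonormal ℝ v) (hvf : ∀ i, fderiv ℝ f x (v i) = 0)
    (hw : Orthonormal ℝ w) (hwf : ∀ i, fderiv ℝ f x (w i) = 0) :
    ∑ i, iteratedFDeriv ℝ 2 f x ![v i, v i] = ∑ i, iteratedFDeriv ℝ 2 f x ![w i, w i] :=
  sum_iteratedFDeriv_two_eq_of_orthonormal finrank_euclideanSpace_fin hf hv hvf hw hwf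

end HessianTrace

/-! ### The round ball: the `0`-handle of the surrounding construction -/

section RoundBall

variable {E : Type*} [NormedAddCommGroup E] [InnerProductSpace ℝ E] {m : ℕ}

/-- The defining function `y ↦ ‖y - c‖² - r²` of the round ball is smooth. [folklore] -/
theorem contDiff_norm_sub_sq_sub (c : E) (r : ℝ) :
    ContDiff ℝ ∞ fun y : E => ‖y - c‖ ^ 2 - r ^ 2 :=
  ((contDiff_id.sub contDiff_const).norm_sq ℝ).sub contDiff_const

/-- The sublevel set `{‖y - c‖² - r² ≤ 0}` is the closed ball of radius `|r|`, hence compact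
(in finite dimension). [folklore] -/
theorem isCompact_setOf_norm_sub_sq_sub_le [FiniteDimensional ℝ E] (c : E) (r : ℝ) :
    IsCompact {y : E | ‖y - c‖ ^ 2 - r ^ 2 ≤ 0} := by
  have : {y : E | ‖y - c‖ ^ 2 - r ^ 2 ≤ 0} = Metric.closedBall c |r| := by
    ext y
    simp only [mem_setOf_eq, sub_nonpos, Metric.mem_closedBall, dist_eq_norm]
    rw [sq_le_sq, abs_norm]
  rw [this]
  exact isCompact_closedBall c |r|

/-- `d(‖· - c‖² - r²)(y) = 2⟨y - c, ·⟩`. [folklore] -/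
theorem hasFDerivAt_norm_sub_sq_sub (c : E) (r : ℝ) (y : E) :
    HasFDerivAt (fun y : E => ‖y - c‖ ^ 2 - r ^ 2) ((2 : ℝ) • innerSL ℝ (y - c)) y := by
  have h := (((hasStrictFDerivAt_norm_sq (y - c)).hasFDerivAt).comp y
    (hasFDerivAt_sub_const c)).sub_const (r ^ 2)
  refine h.congr_fderiv ?_
  ext v
  simp [two_smul]

/-- `d(‖· - c‖² - r²) = (y ↦ 2⟨y - c, ·⟩)` as an equality of functions. [folklore] -/
theorem fderiv_norm_sub_sq_sub (c : E) (r : ℝ) :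
    fderiv ℝ (fun y : E => ‖y - c‖ ^ 2 - r ^ 2) = fun y => (2 : ℝ) • innerSL ℝ (y - c) :=
  funext fun y => (hasFDerivAt_norm_sub_sq_sub c r y).fderiv

/-- The round sphere `{‖y - c‖² = r²}`, `r ≠ 0`, is a regular level. [folklore] -/
theorem fderiv_norm_sub_sq_sub_ne_zero (c : E) {r : ℝ} (hr : r ≠ 0) (y : E)
    (hy : ‖y - c‖ ^ 2 - r ^ 2 = 0) :
    fderiv ℝ (fun y : E => ‖y - c‖ ^ 2 - r ^ 2) y ≠ 0 := by
  rw [(hasFDerivAt_norm_sub_sq_sub c r y).fderiv]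
  intro h
  have h' := DFunLike.congr_fun h (y - c)
  have hyc : ‖y - c‖ ^ 2 = r ^ 2 := sub_eq_zero.mp hy
  rw [smul_apply, innerSL_apply_apply, real_inner_self_eq_norm_sq, hyc, zero_apply,
    smul_eq_mul] at h'
  exact hr (by simpa using h')

/-- The Hessian of `‖· - c‖² - r²` is `2⟨·, ·⟩`. [folklore] -/
theorem iteratedFDeriv_two_norm_sub_sq_sub (c : E) (r : ℝ) (y a b : E) :
    iteratedFDeriv ℝ 2 (fun y : E => ‖y - c‖ ^ 2 - r ^ 2) y ![a, b] = 2 * ⟪a, b⟫ := by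
  rw [iteratedFDeriv_two_vecCons, fderiv_norm_sub_sq_sub]
  have h1 : HasFDerivAt (fun y : E => innerSL ℝ (y - c)) (innerSL ℝ : E →L[ℝ] E →L[ℝ] ℝ) y := by
    have := ((innerSL ℝ : E →L[ℝ] E →L[ℝ] ℝ).hasFDerivAt (x := y - c)).comp y
      (hasFDerivAt_sub_const c)
    rwa [ContinuousLinearMap.comp_id] at this
  have h2 : HasFDerivAt (fun y : E => (2 : ℝ) • innerSL ℝ (y - c))
      ((2 : ℝ) • (innerSL ℝ : E →L[ℝ] E →L[ℝ] ℝ)) y := h1.const_smul (2 : ℝ)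
  rw [h2.fderiv, smul_apply, smul_apply, innerSL_apply_apply, smul_eq_mul]

/-- **The round sphere is mean convex**: at every `y`, every orthonormal `m`-frame `v` gives
`∑ᵢ D²(‖· - c‖² - r²)(y)(vᵢ, vᵢ) = 2m > 0` as soon as `m ≥ 1` (`= ‖∇F₀‖ H` with `H = m / r` on the
sphere of radius `r`). This is the `0`-handle from which the Lawson–Michelsohn surrounding
hypersurface is grown. [folklore] -/
theorem sum_iteratedFDeriv_two_norm_sub_sq_sub_pos (hm : 0 < m) (c : E) (r : ℝ) (y : E)
    (v : Fin m → E) (hv : Orthonormal ℝ v) :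
    0 < ∑ i, iteratedFDeriv ℝ 2 (fun y : E => ‖y - c‖ ^ 2 - r ^ 2) y ![v i, v i] := by
  simp_rw [iteratedFDeriv_two_norm_sub_sq_sub, real_inner_self_eq_norm_sq, hv.1, one_pow,
    mul_one, Finset.sum_const, Finset.card_univ, Fintype.card_fin, nsmul_eq_mul]
  positivity

/-- The round ball `{‖y - c‖² - r² ≤ 0}` of radius `r > 0` in `ℝ^{m+1}`, `m ≥ 1`, satisfies every
`F'`-clause of the conclusion of `LawsonMichelsohn1984_surrounding`: smooth defining function,
compact sublevel set, regular zero level, and positive Hessian trace on every orthonormal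
`m`-frame (in particular on the tangent ones). [folklore] -/
theorem roundBall_presentation (hm : 0 < m) (c : EuclideanSpace ℝ (Fin (m + 1))) {r : ℝ}
    (hr : 0 < r) :
    ContDiff ℝ ∞ (fun y : EuclideanSpace ℝ (Fin (m + 1)) => ‖y - c‖ ^ 2 - r ^ 2) ∧
    IsCompact {y : EuclideanSpace ℝ (Fin (m + 1)) | ‖y - c‖ ^ 2 - r ^ 2 ≤ 0} ∧
    (∀ y, ‖y - c‖ ^ 2 - r ^ 2 = 0 →
      fderiv ℝ (fun y : EuclideanSpace ℝ (Fin (m + 1)) => ‖y - c‖ ^ 2 - r ^ 2) y ≠ 0) ∧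
    ∀ y, ‖y - c‖ ^ 2 - r ^ 2 = 0 → ∀ v : Fin m → EuclideanSpace ℝ (Fin (m + 1)),
      Orthonormal ℝ v →
      (∀ i, fderiv ℝ (fun y : EuclideanSpace ℝ (Fin (m + 1)) => ‖y - c‖ ^ 2 - r ^ 2) y (v i) = 0) →
      0 < ∑ i, iteratedFDeriv ℝ 2
        (fun y : EuclideanSpace ℝ (Fin (m + 1)) => ‖y - c‖ ^ 2 - r ^ 2) y ![v i, v i] :=
  ⟨contDiff_norm_sub_sq_sub c r, isCompact_setOf_norm_sub_sq_sub_le c r,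
    fun y hy => fderiv_norm_sub_sq_sub_ne_zero c hr.ne' y hy,
    fun y _ v hv _ => sum_iteratedFDeriv_two_norm_sub_sq_sub_pos hm c r y v hv⟩

end RoundBall

/-! ### Transport of the `1`-thin hypothesis `RelPiOneTrivial` along homeomorphisms of pairs -/

section RelPiOne

variable {X Y : Type*} [TopologicalSpace X] [TopologicalSpace Y]

/-- **`π₁(X, A) = 0` is invariant under homeomorphisms of pairs**: if every path of `X` with
end-points in `A` compresses into `A` rel end-points, then every path of `Y` with end-points
in `φ(A)` compresses into `φ(A)`, for a homeomorphism `φ : X ≃ₜ Y` (pull the path back by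
`φ⁻¹`, compress, push forward by `φ`; homotopies rel end-points are mapped by `φ`).  Used to
move the `1`-thin hypothesis of `LawsonMichelsohn1984_surrounding` from the subspace
`{F ≤ 0} ⊆ ℝ^{m+1}` to any model of the compact domain `D`. [folklore] -/
theorem RelPiOneTrivial.image_homeomorph {A : Set X} (h : RelPiOneTrivial X A) (φ : X ≃ₜ Y) :
    RelPiOneTrivial Y (φ '' A) := by
  intro y₀ y₁ hy₀ hy₁ γ
  obtain ⟨x₀, hx₀, rfl⟩ := hy₀
  obtain ⟨x₁, hx₁, rfl⟩ := hy₁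
  set γ' : Path x₀ x₁ := (γ.map φ.symm.continuous).cast (φ.symm_apply_apply x₀).symm
    (φ.symm_apply_apply x₁).symm with hγ'
  obtain ⟨δ, hδA, hδ⟩ := h hx₀ hx₁ γ'
  refine ⟨δ.map φ.continuous, ?_, ?_⟩
  · rintro _ ⟨t, rfl⟩
    exact ⟨δ t, hδA (mem_range_self t), rfl⟩
  · have hback : γ'.map φ.continuous = γ := by
      ext t
      simp [hγ']
    rw [← hback]
    exact hδ.map (φ : C(X, Y))

/-- `RelPiOneTrivial` transported along a homeomorphism, with the image described by an
equation `φ '' A = B`. [folklore] -/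
theorem RelPiOneTrivial.of_image_eq {A : Set X} {B : Set Y} (h : RelPiOneTrivial X A)
    (φ : X ≃ₜ Y) (hAB : φ '' A = B) : RelPiOneTrivial Y B :=
  hAB ▸ h.image_homeomorph φ

/-- `RelPiOneTrivial` transported along a homeomorphism, with the subsets described as
preimages: if `B = φ.symm ⁻¹' A` (equivalently `A = φ ⁻¹' B`). [folklore] -/
theorem RelPiOneTrivial.of_preimage_eq {A : Set X} {B : Set Y} (h : RelPiOneTrivial X A)
    (φ : X ≃ₜ Y) (hAB : ∀ x, x ∈ A ↔ φ x ∈ B) : RelPiOneTrivial Y B := by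
  refine h.of_image_eq φ (Set.ext fun y => ⟨?_, fun hy => ⟨φ.symm y, ?_, φ.apply_symm_apply y⟩⟩)
  · rintro ⟨x, hx, rfl⟩
    exact (hAB x).1 hx
  · exact (hAB _).2 (by rwa [φ.apply_symm_apply])

end RelPiOne

end Literature.Geometry.Riemannian

end
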